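import Summits.CriticalPhenomena.PercolationContinuityZ3.Theorems.PercNonProliferationNonProliferationPowerCap
import Summits.CriticalPhenomena.PercolationContinuityZ3.Theorems.PercNonProliferationFreeBoxPowerSavingPairGivesOneArm
import Literature.Probability.Percolation.SharpnessDCTProofs
import HarnessLib

/-!
# Crux `PercNonProliferation.FreeBoxPowerSaving` (stmt-CriticalPhenomena-4447), line `Sketch_r2_ideator4` (card `onearm-currency-arm-cauchy-schwarz`) — stub `stub_unconditionalArmFromCrux`

Helper file for the crux skeleton `Cruxes/FreeBoxPowerSaving/Lines/Sketch_r2_ideator4.lean`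
(lead prover-line-stmt-CriticalPhenomena-4447-a2-0). Proves exactly the registered stub signature
`stub_unconditionalArmFromCrux` (the UNCONDITIONAL corollary of the line's ASP inequality at `p_c` with
the landed `PowerCap`); lands with `--supports stmt-CriticalPhenomena-4447`.

## The statement

Bond percolation `P = P_{p_c}` on `ℤ³`, `B(n) = box 3 n`, `π(m) = oneArmProb 3 p_c m = P(0 ↔ ∂ⁱⁿB(m) in B(m))`,
`E[N_n] = Σ_{k<|B(n)|} P(∃ k+1 points of B(n), each joined inside B(2n) to ∂ⁱⁿB(2n), pairwise not
joined inside B(2n))` (verbatim `Σ_k P(repEvent 3 k n)` of the landed `PowerCap`),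
`FA₂(n) = |B(n)|⁻² Σ_{x,y∈B(n)} P(x ↔ y inside B(n))`.  Then

  ASP at `p_c` (`∀ n ≥ 1, π(3n)² ≤ 64 · E[N_n] · FA₂(2n)`)
  `→ ∃ β > 0, ∀ a C, 2 - β < a → (∀ n ≥ 1, FA₂(n) ≤ C n^{-a}) →`
  `∃ C', ∀ m ≥ 1, π(m) ≤ C' m^{-(a-2+β)/2}`.

## The argument

* `β, C₀` from `NonProliferation.expected_numSpanning_le_rpow` (`E[N_n] ≤ C₀ n^{2-β}`, `n ≥ 1`); at
  `n = 1` both caps bound nonnegative sums, so `0 ≤ C₀`, `0 ≤ C`.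
* One scale `n ≥ 1` (`UnconditionalArmFromCrux.arith`, pure real arithmetic): `E[N_n] ≥ 0`, `FA₂ ≥ 0`,
  so `π(3n)² ≤ 64 · (C₀ n^{2-β}) · (C (2n)^{-a}) = (64 C₀ C 2^{-a}) · n^{2-β-a}` and
  `n^{2-β-a} = (n^{-t})²`, `t := (a-2+β)/2`; hence `π(3n) ≤ √(64 C₀ C 2^{-a}) · n^{-t}`.
* All `m ≥ 1` by the sibling stub file's interpolation lemma
  `PairGivesOneArm.oneArmProb_le_of_three_mul` (`PercNonProliferationFreeBoxPowerSavingPairGivesOneArm`,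
  used with `n₀ := 1`): `m ↦ π(m)` is antitone (`DCT16.real_siteToBoundary_antitone`); for `m ≥ 3` put
  `n := m/3 ≥ 1`, `3n ≤ m ≤ 5n`, so `π(m) ≤ π(3n) ≤ K n^{-t} ≤ K 5^t m^{-t}`; for `m < 3`,
  `π(m) ≤ 1 ≤ 3^t m^{-t}`.  Only `0 ≤ t`, i.e. `2 - β ≤ a`, is needed.

Tree API: `Theorems.NonProliferation.expected_numSpanning_le_rpow`,
`FreeBoxPowerSavingLine.PairGivesOneArm.oneArmProb_le_of_three_mul`.
Mathlib: `Real.mul_rpow`, `Real.rpow_add`, `Real.sq_sqrt`, `pow_le_pow_iff_left₀`, `Real.one_rpow`.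
-/

noncomputable section

namespace Summit.CriticalPhenomena.PercolationContinuityZ3.FreeBoxPowerSavingLine

open MeasureTheory Filter
open Literature.Probability.Percolation Literature.Probability.LatticeModels

namespace UnconditionalArmFromCrux

/-- **The arithmetic of one scale `n ≥ 1`.** Reading `π = π_{p_c}(3n)`, `EN = E[N_n]`, `FA = FA₂(2n)`:
from `π² ≤ 64 · EN · FA`, `EN ≤ C₀ n^{2-β}`, `0 ≤ FA ≤ C (2n)^{-a}`, `0 ≤ C₀`, `0 ≤ C`, `0 ≤ π` one gets
`π ≤ √(64 C₀ C 2^{-a}) · n^{-(a-2+β)/2}` (since `(2n)^{-a} = 2^{-a} n^{-a}` and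
`n^{2-β} n^{-a} = n^{-(a-2+β)} = (n^{-(a-2+β)/2})²`). -/
theorem arith {π EN FA C₀ C a β : ℝ} {n : ℕ} (hn : 1 ≤ n) (hπ : 0 ≤ π) (hC₀ : 0 ≤ C₀) (hC : 0 ≤ C)
    (hA : π ^ 2 ≤ 64 * EN * FA) (hEN : EN ≤ C₀ * (n : ℝ) ^ (2 - β)) (hFA0 : 0 ≤ FA)
    (hFA : FA ≤ C * ((2 * n : ℕ) : ℝ) ^ (-a)) :
    π ≤ Real.sqrt (64 * C₀ * C * (2 : ℝ) ^ (-a)) * (n : ℝ) ^ (-((a - 2 + β) / 2)) := by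
  have hn0 : (0 : ℝ) < n := Nat.cast_pos.2 (Nat.succ_le_iff.1 hn)
  have h2n : ((2 * n : ℕ) : ℝ) ^ (-a) = (2 : ℝ) ^ (-a) * (n : ℝ) ^ (-a) := by
    rw [Nat.cast_mul, Nat.cast_ofNat]
    exact Real.mul_rpow (by norm_num) hn0.le
  have hM0 : 0 ≤ 64 * C₀ * C * (2 : ℝ) ^ (-a) :=
    mul_nonneg (mul_nonneg (mul_nonneg (by norm_num) hC₀) hC) (Real.rpow_nonneg (by norm_num) _)
  have hcomb : (n : ℝ) ^ (2 - β) * (n : ℝ) ^ (-a) = (n : ℝ) ^ (-(a - 2 + β)) := by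
    rw [← Real.rpow_add hn0]
    congr 1
    ring
  have hhalf : ((n : ℝ) ^ (-((a - 2 + β) / 2))) ^ 2 = (n : ℝ) ^ (-(a - 2 + β)) := by
    rw [sq, ← Real.rpow_add hn0]
    congr 1
    ring
  have hsq : π ^ 2 ≤
      (Real.sqrt (64 * C₀ * C * (2 : ℝ) ^ (-a)) * (n : ℝ) ^ (-((a - 2 + β) / 2))) ^ 2 := by
    calc π ^ 2 ≤ 64 * EN * FA := hA
      _ = 64 * (EN * FA) := mul_assoc _ _ _
      _ ≤ 64 * ((C₀ * (n : ℝ) ^ (2 - β)) * (C * ((2 * n : ℕ) : ℝ) ^ (-a))) :=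
          mul_le_mul_of_nonneg_left
            (mul_le_mul hEN hFA hFA0 (mul_nonneg hC₀ (Real.rpow_nonneg hn0.le _))) (by norm_num)
      _ = 64 * C₀ * C * (2 : ℝ) ^ (-a) * ((n : ℝ) ^ (2 - β) * (n : ℝ) ^ (-a)) := by
          rw [h2n]
          ring
      _ = (Real.sqrt (64 * C₀ * C * (2 : ℝ) ^ (-a)) * (n : ℝ) ^ (-((a - 2 + β) / 2))) ^ 2 := by
          rw [hcomb, mul_pow, Real.sq_sqrt hM0, hhalf]
  exact (pow_le_pow_iff_left₀ hπ (mul_nonneg (Real.sqrt_nonneg _) (Real.rpow_nonneg hn0.le _))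
    two_ne_zero).1 hsq

end UnconditionalArmFromCrux

open PairGivesOneArm UnconditionalArmFromCrux in
/-- **Registered stub `stub_unconditionalArmFromCrux`** (crux stmt-CriticalPhenomena-4447, line
`Sketch_r2_ideator4`): ASP at `p_c` together with the landed `PowerCap`
(`NonProliferation.expected_numSpanning_le_rpow`: `E_{p_c}[N_n] ≤ C₀ n^{2-β}`, `β > 0`; its event
`repEvent 3 k n` is the representative event of the hypothesis verbatim) turn a free-box power saving
`FA₂(n) ≤ C n^{-a}` (`n ≥ 1`) with `a > 2 - β` into one-arm decay with exponent `(a-2+β)/2`: at each scale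
`n ≥ 1`, `π(3n)² ≤ 64 · C₀ n^{2-β} · C 2^{-a} n^{-a}`, so `π(3n) ≤ √(64 C₀ C 2^{-a}) · n^{-(a-2+β)/2}`
(`UnconditionalArmFromCrux.arith`), then every `m ≥ 1` by antitonicity of `m ↦ π(m)` and `π ≤ 1`
(`PairGivesOneArm.oneArmProb_le_of_three_mul` with `n₀ = 1`). -/
theorem stub_unconditionalArmFromCrux :
    (∀ n : ℕ, 1 ≤ n →
      oneArmProb 3 (criticalProbI 3) (3 * n) ^ 2 ≤
        64 * (∑ k ∈ Finset.range (box 3 n).card, (bondPercolation (zdGraph 3) (criticalProbI 3)).real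
          {ω | ∃ x : Fin (k + 1) → Site 3, (∀ i, x i ∈ box 3 n) ∧
            (∀ i, ∃ y ∈ innerBoundary (zdGraph 3) (box 3 (2 * n)),
              ω ∈ openConnIn (↑(box 3 (2 * n)) : Set (Site 3)) (x i) y) ∧
            ∀ i j, i ≠ j → ω ∉ openConnIn (↑(box 3 (2 * n)) : Set (Site 3)) (x i) (x j)}) *
        ((∑ x ∈ box 3 (2 * n), ∑ y ∈ box 3 (2 * n),
            (bondPercolation (zdGraph 3) (criticalProbI 3)).real
              (openConnIn (↑(box 3 (2 * n)) : Set (Site 3)) x y)) /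
          ((box 3 (2 * n)).card : ℝ) ^ 2)) →
      ∃ β : ℝ, 0 < β ∧ ∀ a C : ℝ, 2 - β < a →
        (∀ n : ℕ, 1 ≤ n →
          (∑ x ∈ box 3 n, ∑ y ∈ box 3 n,
              (bondPercolation (zdGraph 3) (criticalProbI 3)).real
                (openConnIn (↑(box 3 n) : Set (Site 3)) x y)) /
            ((box 3 n).card : ℝ) ^ 2 ≤ C * (n : ℝ) ^ (-a)) →
        ∃ C' : ℝ, ∀ m : ℕ, 1 ≤ m →
          oneArmProb 3 (criticalProbI 3) m ≤ C' * (m : ℝ) ^ (-((a - 2 + β) / 2)) := by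
  intro hASP
  obtain ⟨β, C₀, hβ, hcap⟩ := Theorems.NonProliferation.expected_numSpanning_le_rpow
  -- `0 ≤ C₀`: at `n = 1` the cap bounds a sum of probabilities
  have hC₀ : 0 ≤ C₀ := by
    have h1 := hcap 1 le_rfl
    rw [Nat.cast_one, Real.one_rpow, mul_one] at h1
    exact le_trans (Finset.sum_nonneg fun _ _ => measureReal_nonneg) h1
  refine ⟨β, hβ, fun a C ha hFA => ?_⟩
  -- `0 ≤ C`: at `n = 1` the crux bounds `FA₂(1) ≥ 0`
  have hC : 0 ≤ C := by
    have h1 := hFA 1 le_rfl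
    rw [Nat.cast_one, Real.one_rpow, mul_one] at h1
    exact le_trans (by positivity) h1
  -- the bound at every scale `3n`, `n ≥ 1` (`repEvent 3 k n` is the representative event by `rfl`)
  have key : ∀ n : ℕ, 1 ≤ n → oneArmProb 3 (criticalProbI 3) (3 * n) ≤
      Real.sqrt (64 * C₀ * C * (2 : ℝ) ^ (-a)) * (n : ℝ) ^ (-((a - 2 + β) / 2)) := fun n hn =>
    arith hn measureReal_nonneg hC₀ hC (hASP n hn) (hcap n hn) (by positivity) (hFA (2 * n) (by omega))
  -- interpolation to every `m ≥ 1`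
  have ht : 0 ≤ (a - 2 + β) / 2 := by linarith
  exact ⟨_, fun m hm => oneArmProb_le_of_three_mul (criticalProbI 3) ht (Real.sqrt_nonneg _)
    (le_refl 1) key hm⟩

end Summit.CriticalPhenomena.PercolationContinuityZ3.FreeBoxPowerSavingLine

end
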